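import Summits.ABC.ABC.Theses.YuMatveevShapeRat
import Summits.ABC.ABC.Theorems.YuMatveevShapeRatPadicCoreOddRatLine
import Summits.ABC.ABC.Theorems.YuMatveevShapeRatPadicCoreTwoRatLine
import Literature.NumberTheory.DiophantineGeometry.ApproximationBoundRatPadicOfCoresProofs
import HarnessLib

/-!
# Sub-rung A1.L(p) by name: the `p`-adic approximation bound over `ℚ` in shape form (`Dioph.padicApproximationBound_rat`) —
# UNCONDITIONAL, from the two Kummer-free `p`-adic cores of route `YuMatveevShapeRat`

`Summits/ABC/ABC/Theorems/YuMatveevShapeRatPadicHalf.lean` — cell `abc-stewartyu` (HOME `run/shared/lean/pub/abc-stewartyu/`), route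
`YuMatveevShapeRat` (rung A1.L, FRONTIER ledger), seat p2 (g8, KEY R4SUPPORT-ASSEMBLY), filed right after the second `p`-adic crux closer
landed: `PadicCoreOddRat` (stmt-ABC-20503, line `sat_odd`, `…SatOddG3Frame.PadicCoreOddRat_proof`, p2 g7) and `PadicCoreTwoRat`
(stmt-ABC-20504, line `padic_two_sat_frame`, `Summit.ABC.ABC.Theorems.PadicCoreTwoRat_proof`, p3 g10, ✓ p578169).  lp-1's landed Literature chain
`Dioph.padicApproximationBound_rat_of_padicCores` (Evertse–Győry §4.4.2 reduction at `α = 1`, both parities) turns the two crux texts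
verbatim into the `p`-adic half of the library rung, `Dioph.padicApproximationBound_rat` = `∃ K ≥ 1`, clause (ii) of
`PastenApproximationBound K`: for non-torsion `ξ₁,…,ξ_m ∈ ℚ*`, `x = ±∏ξᵢ^{bᵢ} ≠ 1` and every prime `p`,
`ord_p(1 − x)·log p < K^m·(p/log p)·log max{e, p·h(x)}·∏ h(ξᵢ)`.
BY-NAME consequences already in the tree fire from this decl through the `K`-parametric bridges
`Literature.Barriers.ABC.…_of_padicApproximationBound_rat` (Stewart–Tijdeman 1986, Stewart–Yu 1991, Stewart–Yu 2001 Thm 1 = `BakerMethodBounds`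
and Thm 2): a SECOND, Kummer-door-free path to the Baker-method abc ladder — not re-declared here, since those statements are theorems of the
tree already (`stewart_yu_holds`, `bakerMethodBounds_holds`, `stewartYu2001_thm2_holds`, `stewartYu1991_holds`, `stewartTijdeman1986_holds`, route
`PadicPrimesKummerThird`) and the gate de-duplicates by statement.  [folklore] assembly.
WHAT THIS IS NOT: the full rung `Dioph.approximationBound_rat` (needs the archimedean crux `ArchCoreRat`, stmt-ABC-20502); an abc claim;
no summit credit (class rung, D-0061).
-/

-- `Summit.<Summit>.<Problem>` is the mandated summit-side namespace (CONVENTIONS §2); for the single-conjunct summit `ABC` the two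
-- coincide, so the duplicate `ABC.ABC` is deliberate.
set_option linter.dupNamespace false

namespace Summit.ABC.ABC.Theorems

open Summit.ABC.ABC.Theses
open Literature.NumberTheory.DiophantineGeometry

/-- **Sub-rung A1.L(p) — the `p`-adic approximation bound over `ℚ` in shape form holds**: `∃ K ≥ 1` such that for non-torsion
`ξ₁,…,ξ_m ∈ ℚ*`, `x = ±∏ξᵢ^{bᵢ} ≠ 1` and every prime `p`, `ord_p(1 − x)·log p < K^m·(p/log p)·log max{e, p·h(x)}·∏ h(ξᵢ)` — from the
Kummer-free odd-`p` and `2`-adic cores. [cite: Pasten2024, Theorem 2.1 (ii) (d = 1)] [cite: EvertseGyory2015, Thm 4.2.1 (p. 68), v finite, K = ℚ, α = 1] -/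
theorem padicApproximationBound_rat_holds : Dioph.padicApproximationBound_rat :=
  Dioph.padicApproximationBound_rat_of_padicCores
    Summit.ABC.ABC.Cruxes.PadicCoreOddRat.SatOddG3Frame.PadicCoreOddRat_proof
    Summit.ABC.ABC.Theorems.PadicCoreTwoRat_proof

end Summit.ABC.ABC.Theorems
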